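import Literature.MathematicalPhysics.QuantumFieldTheory.Chatterjee2019LargeN.MasterLoopConvergence
import HarnessLib

/-!
# Chatterjee 2019, Theorem 9.2 (existence): the trajectory sum is a solution of the master loop equation

S. Chatterjee, *Rigorous solution of strongly coupled `SO(N)` lattice gauge theory in the large `N` limit*,
Comm. Math. Phys. **366** (2019) 203–268 (arXiv:1502.07719), **Theorem 9.2**: «Given any `L ≥ 1`, there exists
`β₀(L,d) > 0` such that if `|β| ≤ β₀(L,d)`, then there is a unique function `φ_β : 𝒮 → ℝ` such that (a)
`φ_β(∅) = 1`, (b) `|φ_β(s)| ≤ L^{|s|}` for all `s`, and (c) `φ_β` satisfies the master loop equation of Theorem 9.1.»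

THEOREMS ONLY (net debt 0).  The EXISTENCE clause, PROVED from Theorem 3.1 (`GaugeStringDuality`) and Theorem 8.1
(`UnsymmetrizedMasterLoopEquation`): the 't Hooft limit `φ_β(s) = lim_N φ_{Λ_N,N,β}(s) = Σ_{X ∈ 𝒳(s)} w_β(X)` is a
cycle function with `φ_β(∅) = 1`, `|φ_β| ≤ 1 ≤ L^{|s|}`, satisfying the equation of Theorem 9.1
(`isMasterLoopSolution_trajectorySum`, `exists_masterLoopSolution`); so of the named fact `MasterLoopUniqueness` only
the uniqueness clause (the contraction argument of §9) remains outstanding given Theorems 3.1 and 8.1.  Also: rotating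
a component keeps a loop sequence genuine (`IsLoopSeq.modify_rotate`).

## WHAT THIS IS NOT
The uniqueness clause of Theorem 9.2 is not proved here; Theorems 3.1 and 8.1 remain named facts.
-/

noncomputable section

open Filter Topology
open Literature.Probability.LatticeModels Literature.MathematicalPhysics.QuantumLattice

namespace Literature.MathematicalPhysics.QuantumFieldTheory.Chatterjee2019LargeN

variable {d : ℕ}

/-- Rotating a component of a genuine loop sequence gives a genuine loop sequence (the components are cycles).
[cite: Chatterjee2019LargeN, §2.1 (loops = nonbacktracking cycles), Theorem 9.2 (φ_β : 𝒮 → ℝ)] -/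
theorem IsLoopSeq.modify_rotate {s : LoopSeq d} (hs : IsLoopSeq s) (i k : ℕ) :
    IsLoopSeq (s.modify i fun l => l.rotate k) := by
  induction s generalizing i with
  | nil => simpa using hs
  | cons l s ih =>
    have hl := hs l (by simp)
    have hs' : IsLoopSeq s := fun w hw => hs w (List.mem_cons_of_mem _ hw)
    cases i with
    | zero =>
      intro w hw
      simp only [List.modify_zero_cons, List.mem_cons] at hw
      rcases hw with rfl | hw
      · exact ⟨hl.1.rotate k, by simpa [List.rotate_eq_nil_iff] using hl.2⟩
      · exact hs' w hw
    | succ i =>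
      intro w hw
      simp only [List.modify_succ_cons, List.mem_cons] at hw
      rcases hw with rfl | hw
      · exact hl
      · exact ih hs' i w hw

/-- **Theorem 9.2, existence clause, PROVED from Theorems 3.1 and 8.1**: for `|β| ≤ β₀(d)` (that of Theorem 3.1) the
trajectory sum `s ↦ Σ_{X ∈ 𝒳(s)} w_β(X)` is a solution of class `L = 1`: a cycle function, `= 1` at `∅`, bounded by `1`
on loop sequences, satisfying the master loop equation of Theorem 9.1. (An exhaustion `Λ_N ↑ ℤ^d` is taken as a
parameter: the solution is identified with `lim_N φ_{Λ_N,N,β}`.) [cite: Chatterjee2019LargeN, Theorem 9.2 (existence of φ_β), Theorem 3.1, Theorem 9.1] -/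
theorem isMasterLoopSolution_trajectorySum (hG : GaugeStringDuality d) (hU : UnsymmetrizedMasterLoopEquation d)
    (hd : 2 ≤ d) {Λ : ℕ → Finset (Literature.Probability.LatticeModels.Site d)} (hΛ : IsExhaustion Λ) :
    ∃ β₀ : ℝ, 0 < β₀ ∧ ∀ β : ℝ, |β| ≤ β₀ →
      IsMasterLoopSolution 1 β (fun s : LoopSeq d => ∑' X : Trajectory s, X.weight β) := by
  obtain ⟨β₀, hβ₀, H⟩ := hG hd
  refine ⟨β₀, hβ₀, fun β hβ => ?_⟩
  have hlim : ∀ s : LoopSeq d, IsLoopSeq s →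
      Tendsto (fun N : ℕ => phi N β (Λ N) s) atTop (𝓝 (∑' X : Trajectory s, X.weight β)) := fun s hs =>
    (H Λ hΛ β hβ s hs).2
  refine ⟨fun s hs i k => ?_, ?_, fun s hs => ?_, ?_⟩
  · refine tendsto_nhds_unique ?_ (hlim s hs)
    simpa only [phi_modify_rotate] using hlim _ (hs.modify_rotate i k)
  · exact tendsto_nhds_unique (hlim [] fun l hl => by simp at hl) (by simpa only [phi_nil] using tendsto_const_nhds)
  · rw [one_pow]
    exact le_of_tendsto' (hlim s hs).abs fun N => abs_phi_le_one _ _ _ _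
  · exact thooftMasterLoopEquation_of_unsymmetrized hU hd Λ hΛ β id strictMono_id _ hlim

/-- Hence, given Theorems 3.1 and 8.1, for every `L ≥ 1` and `|β| ≤ β₀(d)` the solution class of Theorem 9.2 is
non-empty (the existence half of the named fact `MasterLoopUniqueness`, with `β₀` independent of `L`).
[cite: Chatterjee2019LargeN, Theorem 9.2 (existence)] -/
theorem exists_masterLoopSolution (hG : GaugeStringDuality d) (hU : UnsymmetrizedMasterLoopEquation d)
    (hd : 2 ≤ d) {Λ : ℕ → Finset (Literature.Probability.LatticeModels.Site d)} (hΛ : IsExhaustion Λ) :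
    ∃ β₀ : ℝ, 0 < β₀ ∧ ∀ L : ℝ, 1 ≤ L → ∀ β : ℝ, |β| ≤ β₀ →
      ∃ φ : LoopSeq d → ℝ, IsMasterLoopSolution L β φ := by
  obtain ⟨β₀, hβ₀, H⟩ := isMasterLoopSolution_trajectorySum hG hU hd hΛ
  refine ⟨β₀, hβ₀, fun L hL β hβ => ⟨fun s : LoopSeq d => ∑' X : Trajectory s, X.weight β, ?_⟩⟩
  obtain ⟨h1, h2, h3, h4⟩ := H β hβ
  exact ⟨h1, h2, fun s hs => (h3 s hs).trans (by rw [one_pow]; exact one_le_pow₀ hL), h4⟩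

end Literature.MathematicalPhysics.QuantumFieldTheory.Chatterjee2019LargeN

end
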